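import Summits.BirchSwinnertonDyer.BirchSwinnertonDyer.Theorems.KolyvaginRoadThreeSchneiderTamAtThreeHeightLogNumeratorLargePrimeCriterion
import Summits.BirchSwinnertonDyer.BirchSwinnertonDyer.Theorems.KolyvaginRoadThreeSchneiderTamAtThreeHeightLogNumeratorExactLimit
import Summits.BirchSwinnertonDyer.BirchSwinnertonDyer.Theorems.ClassRecordThreeRegCertKernel
import Literature.NumberTheory.EllipticCurves.TateJSecondOrderProofs
import Literature.NumberTheory.EllipticCurves.PadicLogNormProofs
import Literature.NumberTheory.EllipticCurves.BinaryQuarticMinimisationPrimeProofs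
import Summits.BirchSwinnertonDyer.Rank1Residual.GaloisImage.PadicSquareClass
import HarnessLib

/-!
# The `p`-adic height at a SPLIT multiplicative prime — «the height is the logarithm of the numerator
# minus the 𝓛-term»: `ĥ_p^{split}(P) = log_p num x(P) − log_p(u(P))²/log_p(q_E) + O(‖x(P)‖_p⁻¹)`,
# the size of the 𝓛-term from the integer model (every Kodaira type `I_ν`, `ν ≥ 1`), and the
# FIRST-ORDER SPLIT CRITERION «`v_p((num x)^{p−1} − 1) + v_p(log_p q_E) ≠ v_p(den x) ⟹ ĥ_p^{split}(P) ≠ 0`»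

HONEST FRAMING (cell `bsd-stepL`, seat `bsd-stepL-tam3-p2` g4, WIDTH-LEVER lane «closed-form Schneider local factor
from the Tate parametrisation by Kodaira type»; `--supports stmt-BirchSwinnertonDyer-19154 --as helper`): THEOREMS
ONLY, route-free; 0 definitions, 0 named facts, 0 sorry. Nothing here proves Schneider's conjecture, any crux, or
BSD. The crux `SchneiderTamAtThree` (19154) and its twin 19106 live on the NON-split locus, where the seat's chain
`…HeightLogNumerator*` gives the closed form of THE height `heightFourOneCoord` (SW 2013 (4.1)); this file is the
SPLIT twin: at a split multiplicative prime THE canonical height is the modified one,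
`heightSplitCoord = heightFourOneCoord − logUnitParamSq / log_p q_E` (SW 2013 §4.2 p. 16), and the extra
𝓛-term `T(P) = log_p(u(P))²/log_p(q_E)` is NOT small — it has norm `‖x(P)‖_p⁻¹/‖log_p q_E‖_p > ‖x(P)‖_p⁻¹`.

* §1 `norm_logUnitParamSq_eq` — `‖log_p(u(P))²‖ = ‖x(P)‖⁻¹` (any `‖q‖ < 1`; `‖log_E z‖ = ‖z‖`, `‖C²‖ = 1`).
* §2 `norm_heightSplitCoord_eq_max` — THE SPLIT LAW IN NORM: given the first-order law
  `‖ĥ_{4.1}(P) − log_p num x‖ ≤ ‖x‖⁻¹` (the seat's theorem: `p = 3` part 4, `p ≥ 5` `…LargePrimeCriterion`) and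
  `‖log_p num x‖ ≠ ‖x‖⁻¹/‖log_p q‖`: **`‖ĥ_p^{split}(P)‖ = max(‖log_p num x‖, ‖x‖⁻¹/‖log_p q‖)`**, in particular
  `ĥ_p^{split}(P) ≠ 0` (`heightSplitCoord_ne_zero_of_norm_ne`); `…_padic` = the `p ≥ 5` instance with the law
  discharged.
* §3 `norm_unitPart_tateParam_sub_le` — the unit part `u = q·p^{−ord q}` of a Tate parameter to SECOND order from
  `j`: `‖u − (J + 744J²)p^{−ord q}‖ ≤ ‖q‖²`, `J = 1/j(q)` (tree: ATAEC V.3.1(b) to `O(q³)`, `norm_inv_tateJ_sub_add_le`);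
  `norm_padicLog_eq_of_unit_approx` — `‖log_p q‖ = ‖u₁^{p−1} − 1‖` for any `u₁` closer to `u` than that;
  `norm_padicLog_tateParam_eq_of_model` — **for the integer model `⟨a₁,…,a₆⟩` with `Δ = p^ν Δ'`, `p ∤ c₄Δ'`,
  `U = Δ'c₄³ + 744p^νΔ'²`, `p^{v_L} ∥ U^{p−1} − c₄^{6(p−1)}`, `v_L < 2ν`: `‖log_p q_E‖ = p^{−v_L}` for EVERY `q` with
  `j(q) = j`** (the Kodaira type enters through `ν` and `Δ'`; `ν = 1` included).
* Continued in `…HeightLogNumeratorSplitChecker.lean` (the generic FIRST-ORDER SPLIT ROW CHECKER at `p ≥ 5`: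
  `p^α ∥ a^{p−1} − 1` and **`α + v_L ≠ v_p(den x)`** ⟹ `heightSplitCoord ≠ 0` for every Tate parameter, and
  `RegMult.CertSplit W p Q 1`) and `…SplitThree.lean` (the `p = 3` instance through part 4 of the seat's chain).

EVIDENCE (numbers, not adjectives; script `numerics/check_split_law.py` on lane A's REG3CERT/v2 table kit j249895,
3 766 split rows, 3 349 with point data and `v_L < 2ν`): the law «`α ≠ τ := 2k − v_L ⟹ v_p(ĥ^{split}) = min(α, τ)`;
`α = τ ⟹ v_p(ĥ^{split}) ≥ α`, with the first digit as predicted» holds on 3 349/3 349 rows (0 violations; p ∈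
{3,5,7,11,13,17,19,23}); the valuation criterion of §4 fires on 1 011 rows (p = 3: 297 of 961; p = 5: 597), the
digit refinement on 465 more; the silent rows are dominated (1 743/1 873) by tabulated points `Q = p·Q'`
(`p ∣ m₀`, forced by `p ∣ c_ℓ`), where `ĥ(Q) = p²ĥ(Q')` cancels the first digit by construction.

References: [SteinWuthrich2013] §4.2 (p. 16, the split height); [SilvermanATAEC1994] Thm. V.3.1(b), Lemma V.5.1;
[Iwasawa1972PadicL] §4.4; [MazurTateTeitelbaum1986Invent] §II.1; [MazurSteinTate2006] §1; tree: the seat's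
`…HeightLogNumerator{,LargePrime}Criterion`, `…ExactLimit` (§23), ui-o2 `Uniform/UI/O2{SigmaValuation,ScaleTranscendence}`,
lane A `ClassRecordThreeRegCertKernel` (gcd admissibility), `X11b/RegMultCertificateJoin` (`CertSplit`).
-/

noncomputable section

open scoped Classical
open Filter Topology IsUltrametricDist
open WeierstrassCurve Literature.NumberTheory.EllipticCurves
open Literature.NumberTheory.EllipticCurves.SteinWuthrich2013
open Literature.NumberTheory.EllipticCurves.TateCurve
open Literature.NumberTheory.EllipticCurves.Rank1Residual
open Summit.BirchSwinnertonDyer.Uniform.UI.O2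
open Summit.BirchSwinnertonDyer.Rank1Residual Summit.BirchSwinnertonDyer.Rank1Residual.X11b

namespace Summit.BirchSwinnertonDyer.Rank1Residual.X11b.RegMult.HeightLogNumerator

variable {p : ℕ} [Fact p.Prime]

/-! ### §0 Plumbing in `ℚ_p` -/

section Plumbing

/-- `‖p^{−ord x}‖ = ‖x‖⁻¹` for `x ≠ 0`. [folklore] -/
theorem norm_zpow_neg_valuation_eq {x : ℚ_[p]} (hx : x ≠ 0) :
    ‖(p : ℚ_[p]) ^ (-x.valuation)‖ = ‖x‖⁻¹ := by
  rw [norm_zpow, Padic.norm_p, Padic.norm_eq_zpow_neg_valuation hx, inv_zpow]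

/-- **`‖log_p a‖ = ‖a^{p−1} − 1‖` for an integer `a` prime to the odd prime `p`** (its unit part is `a`
itself; Iwasawa normalisation, tree `norm_padicLog_eq_norm_unitPart_pow_sub_one`). [cite: Iwasawa1972PadicL, §4.4] -/
theorem norm_padicLog_intCast_eq (hp2 : p ≠ 2) {a : ℤ} (ha : ¬ (p : ℤ) ∣ a) :
    ‖padicLog p (a : ℚ_[p])‖ = ‖((a : ℚ_[p])) ^ (p - 1) - 1‖ := by
  have hp1 : (1 : ℝ) < p := by exact_mod_cast (Fact.out : p.Prime).one_lt
  have ha1 : ‖(a : ℚ_[p])‖ = 1 := BinaryQuartic.norm_intCast_eq_one ha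
  have ha0 : (a : ℚ_[p]) ≠ 0 := norm_pos_iff.mp (by rw [ha1]; exact one_pos)
  have hval : (a : ℚ_[p]).valuation = 0 := by
    have h := Padic.norm_eq_zpow_neg_valuation ha0
    rw [ha1] at h
    have h' : (p : ℝ) ^ (0 : ℤ) = (p : ℝ) ^ (-(a : ℚ_[p]).valuation) := by rw [zpow_zero]; exact h
    have := zpow_right_injective₀ (by positivity) hp1.ne' h'
    omega
  rw [norm_padicLog_eq_norm_unitPart_pow_sub_one hp2 ha0, hval, neg_zero, zpow_zero, mul_one]

end Plumbing

/-! ### §1 The size of `log_p(u(P))²` -/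

section LogUnit

variable {W : WeierstrassCurve ℚ}

/-- **`‖log_p(u(P))²‖_p = ‖x(P)‖_p⁻¹`** for `W/ℚ` globally minimal, multiplicative at the odd prime `p`, any
`‖q‖_p < 1` and any rational affine `P = (x, y)` with `‖x‖_p > 1`: `logUnitParamSq = log_E(z)²/C²` with
`‖log_E(z)‖ = ‖z‖` (formal logarithm isometry), `‖z‖² = ‖x‖⁻¹`, `‖C²‖ = 1` (the uniformisation scale is a
unit). [cite: SteinWuthrich2013, §4.2] [cite: SilvermanAEC2009, IV.6.4, VII.2.2] -/
theorem norm_logUnitParamSq_eq (hp2 : p ≠ 2) [W.IsElliptic] [W.IsGloballyMinimal] (hW : Mult W p)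
    {q : ℚ_[p]} (hq : ‖q‖ < 1) {x y : ℚ} (hxy : W.toAffine.Nonsingular x y) (hx : 1 < ‖(x : ℚ_[p])‖) :
    ‖logUnitParamSq W p q x y‖ = ‖(x : ℚ_[p])‖⁻¹ := by
  unfold logUnitParamSq
  rw [norm_div, norm_pow, norm_padicFormalLog_param_eq hp2 hxy hx, (norm_neg_div_of_one_lt_norm hxy hx).2,
    norm_uniformisationScaleSq_eq_one hW hq, div_one]

end LogUnit

/-! ### §2 The split law in norm and the abstract criterion -/

section SplitLaw

variable {W : WeierstrassCurve ℚ}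

/-- The split height on coordinates is the (4.1) height minus the 𝓛-term `log_p(u)²/log_p(q)` — by `rfl`
(SW 2013 §4.2, p. 16). [cite: SteinWuthrich2013, §4.2] -/
theorem heightSplitCoord_eq_sub (q : ℚ_[p]) (x y : ℚ) :
    heightSplitCoord W p q x y = heightFourOneCoord W p q x y - logUnitParamSq W p q x y / padicLog p q := rfl

/-- **THE SPLIT LAW IN NORM.** `W/ℚ` globally minimal, multiplicative at the odd prime `p`; `q ≠ 0`, `‖q‖_p < 1`,
`log_p q ≠ 0`; `P = (x, y)` rational affine with `‖x‖_p > 1`; GIVEN the first-order law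
`‖ĥ_{4.1}(P) − log_p num x‖ ≤ ‖x‖⁻¹` and `‖log_p num x‖ ≠ ‖x‖⁻¹/‖log_p q‖`:
**`‖ĥ^{split}(P)‖ = max(‖log_p num x‖, ‖x‖⁻¹/‖log_p q‖)`.** Mechanism: `ĥ^{split} = (ĥ_{4.1} − log_p num x) +
(log_p num x − T)` with `‖T‖ = ‖x‖⁻¹/‖log_p q‖ > ‖x‖⁻¹ ≥ ‖ĥ_{4.1} − log_p num x‖` (`‖log_p q‖ < 1` always),
and two norms that differ do not cancel (ultrametric). [cite: SteinWuthrich2013, §4.2] [cite: Iwasawa1972PadicL, §4.4] -/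
theorem norm_heightSplitCoord_eq_max (hp2 : p ≠ 2) [W.IsElliptic] [W.IsGloballyMinimal] (hW : Mult W p)
    {q : ℚ_[p]} (hq0 : q ≠ 0) (hq : ‖q‖ < 1) (hL : padicLog p q ≠ 0) {x y : ℚ}
    (hxy : W.toAffine.Nonsingular x y) (hx : 1 < ‖(x : ℚ_[p])‖)
    (hlaw : ‖heightFourOneCoord W p q x y - padicLog p ((x.num : ℚ) : ℚ_[p])‖ ≤ ‖(x : ℚ_[p])‖⁻¹)
    (hne : ‖padicLog p ((x.num : ℚ) : ℚ_[p])‖ ≠ ‖(x : ℚ_[p])‖⁻¹ / ‖padicLog p q‖) :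
    ‖heightSplitCoord W p q x y‖ =
      max ‖padicLog p ((x.num : ℚ) : ℚ_[p])‖ (‖(x : ℚ_[p])‖⁻¹ / ‖padicLog p q‖) := by
  set h : ℚ_[p] := heightFourOneCoord W p q x y with hh
  set ℓa : ℚ_[p] := padicLog p ((x.num : ℚ) : ℚ_[p]) with hℓa
  set L : ℚ_[p] := padicLog p q with hLdef
  set T : ℚ_[p] := logUnitParamSq W p q x y / L with hT
  set B : ℝ := ‖(x : ℚ_[p])‖⁻¹ / ‖L‖ with hB
  have hsplit : heightSplitCoord W p q x y = (ℓa - T) + (h - ℓa) := by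
    rw [heightSplitCoord_eq_sub]; ring
  have hLpos : 0 < ‖L‖ := norm_pos_iff.mpr hL
  have hLn : ‖L‖ < 1 := by
    rw [hLdef, norm_padicLog_eq_norm_unitPart_pow_sub_one hp2 hq0]
    exact norm_pow_sub_one_lt_one_of_norm_eq_one (norm_mul_zpow_neg_valuation hq0)
  have hTn : ‖T‖ = B := by rw [hT, norm_div, norm_logUnitParamSq_eq hp2 hW hq hxy hx]
  have hxpos : 0 < ‖(x : ℚ_[p])‖⁻¹ := inv_pos.mpr (one_pos.trans hx)
  have hxB : ‖(x : ℚ_[p])‖⁻¹ < B := by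
    rw [hB, lt_div_iff₀ hLpos]
    calc ‖(x : ℚ_[p])‖⁻¹ * ‖L‖ < ‖(x : ℚ_[p])‖⁻¹ * 1 := mul_lt_mul_of_pos_left hLn hxpos
      _ = ‖(x : ℚ_[p])‖⁻¹ := mul_one _
  have h1 : ‖h - ℓa‖ < B := hlaw.trans_lt hxB
  rcases lt_or_gt_of_ne hne with hlt | hgt
  · -- `‖log_p num x‖ < ‖T‖`: the 𝓛-term leads
    have h2 : ‖ℓa - T‖ = B := by
      rw [sub_eq_add_neg, add_comm, norm_add_eq_max_of_norm_ne_norm (by rw [norm_neg, hTn]; exact hlt.ne'),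
        norm_neg, hTn, max_eq_left hlt.le]
    rw [hsplit, norm_add_eq_max_of_norm_ne_norm (by rw [h2]; exact h1.ne'), h2, max_eq_left h1.le,
      max_eq_right hlt.le]
  · -- `‖log_p num x‖ > ‖T‖`: the numerator leads
    have h2 : ‖ℓa - T‖ = ‖ℓa‖ := by
      rw [sub_eq_add_neg, norm_add_eq_max_of_norm_ne_norm (by rw [norm_neg, hTn]; exact hgt.ne'), norm_neg,
        hTn, max_eq_left hgt.le]
    have h3 : ‖h - ℓa‖ < ‖ℓa - T‖ := by rw [h2]; exact h1.trans hgt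
    rw [hsplit, norm_add_eq_max_of_norm_ne_norm h3.ne', max_eq_left h3.le, h2, max_eq_left hgt.le]

/-- **The abstract FIRST-ORDER SPLIT CRITERION**: under the hypotheses of `norm_heightSplitCoord_eq_max`,
`ĥ^{split}(P) ≠ 0` — indeed `‖ĥ^{split}(P)‖ ≥ ‖x‖⁻¹/‖log_p q‖ > 0`. [cite: SteinWuthrich2013, §4.2] -/
theorem heightSplitCoord_ne_zero_of_norm_ne (hp2 : p ≠ 2) [W.IsElliptic] [W.IsGloballyMinimal] (hW : Mult W p)
    {q : ℚ_[p]} (hq0 : q ≠ 0) (hq : ‖q‖ < 1) (hL : padicLog p q ≠ 0) {x y : ℚ}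
    (hxy : W.toAffine.Nonsingular x y) (hx : 1 < ‖(x : ℚ_[p])‖)
    (hlaw : ‖heightFourOneCoord W p q x y - padicLog p ((x.num : ℚ) : ℚ_[p])‖ ≤ ‖(x : ℚ_[p])‖⁻¹)
    (hne : ‖padicLog p ((x.num : ℚ) : ℚ_[p])‖ ≠ ‖(x : ℚ_[p])‖⁻¹ / ‖padicLog p q‖) :
    heightSplitCoord W p q x y ≠ 0 := by
  have hB : 0 < ‖(x : ℚ_[p])‖⁻¹ / ‖padicLog p q‖ :=
    div_pos (inv_pos.mpr (one_pos.trans hx)) (norm_pos_iff.mpr hL)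
  have h := norm_heightSplitCoord_eq_max hp2 hW hq0 hq hL hxy hx hlaw hne
  intro h0
  rw [h0, norm_zero] at h
  have : ‖(x : ℚ_[p])‖⁻¹ / ‖padicLog p q‖ ≤ 0 := by rw [h]; exact le_max_right _ _
  exact absurd this (not_le.mpr hB)

/-- **The split criterion at `p ≥ 5` with the law discharged** by the seat's
`norm_heightFourOneCoord_sub_padicLog_num_le_padic` (any `‖q‖ < 1`, any nonsingular rational point with
`‖x‖_p > 1`). [cite: SteinWuthrich2013, §4.1 eq. (4.1), §4.2] -/
theorem heightSplitCoord_ne_zero_of_norm_ne_padic (hp5 : 5 ≤ p) [W.IsElliptic] [W.IsGloballyMinimal]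
    (hW : Mult W p) {q : ℚ_[p]} (hq0 : q ≠ 0) (hq : ‖q‖ < 1) (hL : padicLog p q ≠ 0) {x y : ℚ}
    (hxy : W.toAffine.Nonsingular x y) (hx : 1 < ‖(x : ℚ_[p])‖)
    (hne : ‖padicLog p ((x.num : ℚ) : ℚ_[p])‖ ≠ ‖(x : ℚ_[p])‖⁻¹ / ‖padicLog p q‖) :
    heightSplitCoord W p q x y ≠ 0 :=
  heightSplitCoord_ne_zero_of_norm_ne (by omega) hW hq0 hq hL hxy hx
    (norm_heightFourOneCoord_sub_padicLog_num_le_padic hp5 hW hq hxy hx) hne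

end SplitLaw

/-! ### §3 `‖log_p q_E‖` from the integer model (the Kodaira type `I_ν` enters here) -/

section TateLog

/-- **The unit part of a Tate parameter to second order from `j`.** For `q ≠ 0`, `‖q‖ < 1`, `J = 1/j(q)`:
`‖q·p^{−ord q} − (J + 744J²)·p^{−ord q}‖ ≤ ‖q‖²` (`q = J + 744J² + O(J³)`, ATAEC V.3.1(b):
`norm_inv_tateJ_sub_add_le`, `norm_inv_tateJ_sub_le`). [cite: SilvermanATAEC1994, Thm. V.3.1(b), Lemma V.5.1] -/
theorem norm_unitPart_tateParam_sub_le {q : ℚ_[p]} (hq0 : q ≠ 0) (hq : ‖q‖ < 1) :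
    ‖q * (p : ℚ_[p]) ^ (-q.valuation) -
        ((tateJ q)⁻¹ + 744 * (tateJ q)⁻¹ ^ 2) * (p : ℚ_[p]) ^ (-q.valuation)‖ ≤ ‖q‖ ^ 2 := by
  set J : ℚ_[p] := (tateJ q)⁻¹ with hJ
  have hJn : ‖J‖ = ‖q‖ := by rw [hJ, norm_inv, norm_tateJ_eq hq, inv_inv]
  have h3 : ‖q - (J + 744 * J ^ 2)‖ ≤ ‖q‖ ^ 3 := by
    have e : q - (J + 744 * J ^ 2) = -(J - q + 744 * q ^ 2) + 744 * ((q - J) * (q + J)) := by ring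
    rw [e]
    refine (norm_add_le_max _ _).trans (max_le ?_ ?_)
    · rw [norm_neg]; exact norm_inv_tateJ_sub_add_le hq
    · rw [norm_mul, norm_mul]
      have h744 : ‖(744 : ℚ_[p])‖ ≤ 1 := by
        rw [show (744 : ℚ_[p]) = ((744 : ℤ) : ℚ_[p]) by norm_cast]; exact Padic.norm_int_le_one _
      have hqJ : ‖q - J‖ ≤ ‖q‖ * ‖q‖ := by rw [norm_sub_rev]; exact norm_inv_tateJ_sub_le hq
      have hqJ' : ‖q + J‖ ≤ ‖q‖ := (norm_add_le_max _ _).trans (max_le le_rfl hJn.le)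
      calc ‖(744 : ℚ_[p])‖ * (‖q - J‖ * ‖q + J‖) ≤ 1 * ((‖q‖ * ‖q‖) * ‖q‖) :=
            mul_le_mul h744 (mul_le_mul hqJ hqJ' (norm_nonneg _) (by positivity)) (by positivity)
              zero_le_one
        _ = ‖q‖ ^ 3 := by ring
  have hpv : ‖(p : ℚ_[p]) ^ (-q.valuation)‖ = ‖q‖⁻¹ := norm_zpow_neg_valuation_eq hq0
  have hq' : ‖q‖ ≠ 0 := norm_ne_zero_iff.mpr hq0
  calc ‖q * (p : ℚ_[p]) ^ (-q.valuation) - (J + 744 * J ^ 2) * (p : ℚ_[p]) ^ (-q.valuation)‖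
        = ‖(q - (J + 744 * J ^ 2)) * (p : ℚ_[p]) ^ (-q.valuation)‖ := by ring_nf
    _ = ‖q - (J + 744 * J ^ 2)‖ * ‖q‖⁻¹ := by rw [norm_mul, hpv]
    _ ≤ ‖q‖ ^ 3 * ‖q‖⁻¹ := by gcongr
    _ = ‖q‖ ^ 2 := by field_simp

/-- **`‖log_p q‖ = ‖u₁^{p−1} − 1‖` for any approximation `u₁` of the unit part `u` of `q` with
`‖u − u₁‖ < ‖u₁^{p−1} − 1‖`** (`p` odd): `‖log_p q‖ = ‖u^{p−1} − 1‖` (Iwasawa), and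
`‖(u^{p−1} − 1) − (u₁^{p−1} − 1)‖ ≤ ‖u − u₁‖`. [cite: Iwasawa1972PadicL, §4.4] -/
theorem norm_padicLog_eq_of_unit_approx (hp2 : p ≠ 2) {q u₁ : ℚ_[p]} (hq0 : q ≠ 0) (hu₁ : ‖u₁‖ ≤ 1)
    (happ : ‖q * (p : ℚ_[p]) ^ (-q.valuation) - u₁‖ < ‖u₁ ^ (p - 1) - 1‖) :
    ‖padicLog p q‖ = ‖u₁ ^ (p - 1) - 1‖ := by
  set u : ℚ_[p] := q * (p : ℚ_[p]) ^ (-q.valuation) with hu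
  have hun : ‖u‖ = 1 := norm_mul_zpow_neg_valuation hq0
  rw [norm_padicLog_eq_norm_unitPart_pow_sub_one hp2 hq0, ← hu]
  -- `‖uⁿ − u₁ⁿ‖ ≤ ‖u − u₁‖` (both of norm `≤ 1`)
  have hpow : ∀ n : ℕ, ‖u ^ n - u₁ ^ n‖ ≤ ‖u - u₁‖ := by
    intro n
    induction n with
    | zero => simp
    | succ n ih =>
      have hid : u ^ (n + 1) - u₁ ^ (n + 1) = u * (u ^ n - u₁ ^ n) + u₁ ^ n * (u - u₁) := by ring
      rw [hid]
      refine (norm_add_le_max _ _).trans (max_le ?_ ?_)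
      · rw [norm_mul]
        calc ‖u‖ * ‖u ^ n - u₁ ^ n‖ ≤ 1 * ‖u - u₁‖ := mul_le_mul hun.le ih (norm_nonneg _) zero_le_one
          _ = ‖u - u₁‖ := one_mul _
      · rw [norm_mul, norm_pow]
        calc ‖u₁‖ ^ n * ‖u - u₁‖ ≤ 1 * ‖u - u₁‖ :=
              mul_le_mul_of_nonneg_right (pow_le_one₀ (norm_nonneg _) hu₁) (norm_nonneg _)
          _ = ‖u - u₁‖ := one_mul _
  have hd : ‖(u ^ (p - 1) - 1) - (u₁ ^ (p - 1) - 1)‖ < ‖u₁ ^ (p - 1) - 1‖ := by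
    rw [show (u ^ (p - 1) - 1) - (u₁ ^ (p - 1) - 1) = u ^ (p - 1) - u₁ ^ (p - 1) by ring]
    exact (hpow _).trans_lt happ
  have h := norm_add_eq_max_of_norm_ne_norm hd.ne'
  rw [add_sub_cancel, max_eq_left hd.le] at h
  exact h

/-- `1/j = Δ/c₄³` read in `ℚ_p` for the integer model `⟨a₁,…,a₆⟩` (`c₄`, `Δ` by the integer formulas).
[cite: SilvermanAEC2009, III.1] -/
theorem ratCast_j_inv_eq_padic (W : WeierstrassCurve ℚ) {a₁ a₂ a₃ a₄ a₆ : ℤ} (hW : W = ⟨a₁, a₂, a₃, a₄, a₆⟩)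
    [W.IsElliptic] {c4 D : ℤ} (hc4 : c4 = (a₁ ^ 2 + 4 * a₂) ^ 2 - 24 * (2 * a₄ + a₁ * a₃))
    (hD : D = -(a₁ ^ 2 + 4 * a₂) ^ 2 * (a₁ ^ 2 * a₆ + 4 * a₂ * a₆ - a₁ * a₃ * a₄ + a₂ * a₃ ^ 2 - a₄ ^ 2) -
      8 * (2 * a₄ + a₁ * a₃) ^ 3 - 27 * (a₃ ^ 2 + 4 * a₆) ^ 2 + 9 * (a₁ ^ 2 + 4 * a₂) * (2 * a₄ + a₁ * a₃) * (a₃ ^ 2 + 4 * a₆)) :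
    ((W.j : ℚ_[p]))⁻¹ = (D : ℚ_[p]) / (c4 : ℚ_[p]) ^ 3 := by
  have hΔ : W.Δ = (D : ℚ) := by
    subst hW; subst hD
    simp only [WeierstrassCurve.Δ, WeierstrassCurve.b₂, WeierstrassCurve.b₄, WeierstrassCurve.b₆, WeierstrassCurve.b₈]
    push_cast; ring
  have hc4' : W.c₄ = (c4 : ℚ) := by
    subst hW; subst hc4
    simp only [WeierstrassCurve.c₄, WeierstrassCurve.b₂, WeierstrassCurve.b₄]
    push_cast; ring
  have hj : W.j = (c4 : ℚ) ^ 3 / (D : ℚ) := by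
    rw [WeierstrassCurve.j, Units.val_inv_eq_inv_val, WeierstrassCurve.coe_Δ', hΔ, hc4', div_eq_mul_inv, mul_comm]
  rw [hj]; push_cast; rw [inv_div]

/-- **`‖log_p q_E‖_p` FROM THE INTEGER MODEL, every Kodaira type `I_ν` (`ν ≥ 1`).** For `W = ⟨a₁,…,a₆⟩` (integer
coefficients), `c₄` and `Δ = p^ν·Δ'` by the integer formulas with `p ∤ c₄`, `p ∤ Δ'` (multiplicative reduction,
type `I_ν`), `U = Δ'c₄³ + 744p^νΔ'²`, `N_L = U^{p−1} − c₄^{6(p−1)}`, `p^{v_L} ∣ N_L`, `p^{v_L+1} ∤ N_L`, `v_L < 2ν`: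
EVERY `q ∈ ℚ_p` with `q ≠ 0`, `‖q‖ < 1`, `j(q) = j(W)` (the Tate parameter; unique) has **`‖log_p q‖_p = p^{−v_L}`**.
Indeed `1/j = p^νΔ'/c₄³`, `ord q = ν`, the unit part is `u ≡ u₁ = U/c₄⁶ (mod p^{2ν})` (§3 first lemma) and
`‖u₁^{p−1} − 1‖ = ‖N_L‖ = p^{−v_L} > p^{−2ν}`. [cite: SilvermanATAEC1994, Thm. V.3.1(b), Lemma V.5.1]
[cite: Iwasawa1972PadicL, §4.4] -/
theorem norm_padicLog_tateParam_eq_of_model (hp2 : p ≠ 2) (W : WeierstrassCurve ℚ) {a₁ a₂ a₃ a₄ a₆ : ℤ}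
    (hW : W = ⟨a₁, a₂, a₃, a₄, a₆⟩) [W.IsElliptic] {c4 Dp U NL : ℤ} {ν vL : ℕ}
    (hc4 : c4 = (a₁ ^ 2 + 4 * a₂) ^ 2 - 24 * (2 * a₄ + a₁ * a₃))
    (hD : (p : ℤ) ^ ν * Dp = -(a₁ ^ 2 + 4 * a₂) ^ 2 * (a₁ ^ 2 * a₆ + 4 * a₂ * a₆ - a₁ * a₃ * a₄ + a₂ * a₃ ^ 2 - a₄ ^ 2) -
      8 * (2 * a₄ + a₁ * a₃) ^ 3 - 27 * (a₃ ^ 2 + 4 * a₆) ^ 2 + 9 * (a₁ ^ 2 + 4 * a₂) * (2 * a₄ + a₁ * a₃) * (a₃ ^ 2 + 4 * a₆))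
    (hpc4 : ¬ (p : ℤ) ∣ c4) (hpDp : ¬ (p : ℤ) ∣ Dp)
    (hU : U = Dp * c4 ^ 3 + 744 * (p : ℤ) ^ ν * Dp ^ 2) (hNL : NL = U ^ (p - 1) - c4 ^ (6 * (p - 1)))
    (h1 : (p : ℤ) ^ vL ∣ NL) (h2 : ¬ (p : ℤ) ^ (vL + 1) ∣ NL) (hvL : vL < 2 * ν)
    {q : ℚ_[p]} (hq0 : q ≠ 0) (hq : ‖q‖ < 1) (hj : tateJ q = (W.j : ℚ_[p])) :
    ‖padicLog p q‖ = (p : ℝ) ^ (-(vL : ℤ)) := by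
  have hp1 : (1 : ℝ) < p := by exact_mod_cast (Fact.out : p.Prime).one_lt
  have hp0 : (p : ℚ_[p]) ≠ 0 := by exact_mod_cast (Fact.out : p.Prime).ne_zero
  have hc4n : ‖(c4 : ℚ_[p])‖ = 1 := BinaryQuartic.norm_intCast_eq_one hpc4
  have hDpn : ‖(Dp : ℚ_[p])‖ = 1 := BinaryQuartic.norm_intCast_eq_one hpDp
  have hc40 : (c4 : ℚ_[p]) ≠ 0 := norm_pos_iff.mp (by rw [hc4n]; exact one_pos)
  -- `1/j = p^ν Dp / c4³`
  have hJ : (tateJ q)⁻¹ = (p : ℚ_[p]) ^ ν * (Dp : ℚ_[p]) / (c4 : ℚ_[p]) ^ 3 := by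
    rw [hj, ratCast_j_inv_eq_padic (p := p) W hW hc4 hD]
    push_cast; ring
  -- `‖q‖ = p^{−ν}`, `ord q = ν`
  have hpn : ‖(p : ℚ_[p]) ^ ν‖ = (p : ℝ) ^ (-(ν : ℤ)) := by
    rw [norm_pow, Padic.norm_p, ← zpow_natCast, inv_zpow']
  have hqn : ‖q‖ = (p : ℝ) ^ (-(ν : ℤ)) := by
    rw [← inv_inv ‖q‖, ← norm_tateJ_eq hq, ← norm_inv, hJ, norm_div, norm_mul, hpn, norm_pow, hc4n, hDpn,
      one_pow, div_one, mul_one]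
  have hval : q.valuation = ν := by
    have h := Padic.norm_eq_zpow_neg_valuation hq0
    rw [hqn] at h
    have := zpow_right_injective₀ (by positivity) hp1.ne' h
    omega
  -- the approximation `u₁ = U/c4⁶`
  set u₁ : ℚ_[p] := (U : ℚ_[p]) / (c4 : ℚ_[p]) ^ 6 with hu₁
  have hu₁eq : ((tateJ q)⁻¹ + 744 * (tateJ q)⁻¹ ^ 2) * (p : ℚ_[p]) ^ (-q.valuation) = u₁ := by
    rw [hval, hJ, hu₁, hU, zpow_neg, zpow_natCast]
    push_cast
    field_simp
  have hu₁n : ‖u₁‖ ≤ 1 := by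
    rw [hu₁, norm_div, norm_pow, hc4n, one_pow, div_one]; exact Padic.norm_int_le_one _
  have hkey : ‖u₁ ^ (p - 1) - 1‖ = (p : ℝ) ^ (-(vL : ℤ)) := by
    have e : u₁ ^ (p - 1) - 1 = (NL : ℚ_[p]) / (c4 : ℚ_[p]) ^ (6 * (p - 1)) := by
      rw [hNL, hu₁]; push_cast
      rw [div_pow, ← pow_mul, sub_div, div_self (pow_ne_zero _ hc40)]
    rw [e, norm_div, norm_pow, hc4n, one_pow, div_one, GaloisImage.PadicSquareClass.norm_intCast_padic_eq h1 h2]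
  have happ : ‖q * (p : ℚ_[p]) ^ (-q.valuation) - u₁‖ < ‖u₁ ^ (p - 1) - 1‖ := by
    rw [hkey, ← hu₁eq]
    refine (norm_unitPart_tateParam_sub_le hq0 hq).trans_lt ?_
    rw [hqn, ← zpow_natCast, ← zpow_mul]
    exact zpow_lt_zpow_right₀ hp1 (by push_cast; omega)
  rw [norm_padicLog_eq_of_unit_approx hp2 hq0 hu₁n happ, hkey]

end TateLog

end Summit.BirchSwinnertonDyer.Rank1Residual.X11b.RegMult.HeightLogNumerator

end
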